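import Summits.Schanuel.Schanuel.Theses.RoyCriterion

/-!
# Uniformity in `N` and non-vacuity of Roy's hypothesis (calibration lemmas for crux `stmt-Schanuel-0463`)

Crux `Summit.Schanuel.Schanuel.Theses.RoyCriterion.RoyThesisTyped = ∀ n, RoyCriterion n` (Roy 2001,
Acta Arith. 97, §1, Conjecture 2). The small-value hypothesis `RoyHypothesis` asks for polynomials
`P_N` for ALL large `N` (`∀ᶠ`). This file records, kernel-checked and def-free:

* `RoyThesisTyped.not_royHypothesis_one_two` — NON-VACUITY: at the algebraic point `(1, 2)` the
  hypothesis FAILS for every admissible window (Roy's Thm 1 `(b) ⇒ (a)`, tree theorem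
  `royThm1BtoA_holds`, + Hermite, tree theorem `transcendental_exp_holds`), while it holds on the
  graph of `exp` (tree theorem `royHypothesis_exp'`).
* `RoyThesisTyped.not_frequently_conditionB_of_norm_ne_one` — OFF the circle `|αe^{−y}| = 1` even
  the `∃ᶠ N` weakening of condition (b) fails (the tree's `prop3_core` works at every large scale
  there); `RoyThesisTyped.frequentlyVariantRankOne_of_norm_ne_one` packages it.
* `RoyThesisTyped.not_frequently_conditionB_of_irrationalityMeasure` — ON the circle, a finite
  irrationality measure of `arg(αe^{−y})/2π` kills the `∃ᶠ` weakening as well.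
* `RoyThesisTyped.frequentlyVariantRankOne_of_baker` — hence, MODULO the irrationality-measure form
  of Baker's inhomogeneous theorem at algebraic points (stated inline as a hypothesis; not in the
  tree), Roy's criterion in rank one survives the weakening `∀ᶠ N ↦ ∃ᶠ N`: uniformity in `N` is
  NOT load-bearing in rank one (contrast crux `RoySmallValueDirichletGap`, whose `∃ᶠ` variant is
  false: `RoySmallValueDirichletGap/Negative/FrequentlyFalse.lean`).

Everything is proved from the tree (`RoyCriterionProp3Proofs.lean`); no defs, no named facts beyond
the inline hypothesis of the last theorem.
-/

set_option linter.dupNamespace false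

noncomputable section

namespace Summit.Schanuel.Schanuel.Theorems

open MvPolynomial Filter Complex
open Literature.NumberTheory.Transcendental

/-- **The hypothesis has teeth**: at the algebraic point `(y, α) = (1, 2)` (off every torsion
translate of the graph of `exp`: `2^d ≠ e^d` by Hermite) Roy's small-value hypothesis FAILS for
every admissible window — Roy's Theorem 1 `(b) ⇒ (a)` (tree theorem `royThm1BtoA_holds`) plus
Hermite–Lindemann (tree theorem `transcendental_exp_holds`). So the crux's hypothesis is neither
unsatisfiable (it holds on the graph of `exp`, `royHypothesis_exp'`) nor universally satisfiable.
[cite: Roy2001, Thm. 1] -/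
theorem RoyThesisTyped.not_royHypothesis_one_two {s₀ s₁ t₀ t₁ u : ℝ}
    (hadm : RoyAdmissible s₀ s₁ t₀ t₁ u) :
    ¬ RoyHypothesis ![(1 : ℂ)] ![(2 : ℂ)] s₀ s₁ t₀ t₁ u := by
  intro h
  have hB : RoyConditionB 1 2 s₀ s₁ t₀ t₁ u := by
    simpa using royConditionB_of_royHypothesis h 0
  obtain ⟨d, hd1, hd⟩ := royThm1BtoA_holds 1 2 two_ne_zero s₀ s₁ t₀ t₁ u hadm hB
  rw [mul_one] at hd
  have hd0 : (d : ℂ) ≠ 0 := by exact_mod_cast (show d ≠ 0 by omega)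
  have htr : Transcendental ℚ (cexp (d : ℂ)) := transcendental_exp_holds (isAlgebraic_nat d) hd0
  apply htr
  rw [← hd]
  exact (isAlgebraic_nat 2).pow d

/-- **Off the circle `|α| = e^{Re y}` the small-value hypothesis fails at EVERY large scale, so even
its `∃ᶠ N` weakening fails**: for `α ≠ 0` with `|α e^{−y}| ≠ 1` and Roy's Proposition-3
inequalities `max{1, t₀, 2t₁} < min{s₀, 2s₁} < u`, there are NOT infinitely many `M` carrying a
polynomial `Q_M` as in condition (b). (The tree's `prop3_core` needs only the separation
`|βʲ − 1| ≥ | |β| − 1 | > 0`, available at every scale; Lemma 4 — the source of the printed `∀ᶠ` —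
enters only when `|β| = 1`.) Hence the uniformity-in-`N` mutation of the crux (`∃ᶠ` for `∀ᶠ`) can
only be decided ON the circle, where it is the irrationality measure of `arg(αe^{−y})/2π` that
matters (finite for algebraic `(y, α)` by Baker's inhomogeneous theorem, not in the tree).
[cite: Roy2001, Prop. 3 (case |αe^{-y}| ≠ 1)] -/
theorem RoyThesisTyped.not_frequently_conditionB_of_norm_ne_one {y α : ℂ} (hα : α ≠ 0)
    {s₀ s₁ t₀ t₁ u : ℝ} (hs₀ : 0 < s₀) (ht₁ : 0 < t₁) (hu : 0 < u)
    (h1 : max 1 (max t₀ (2 * t₁)) < min s₀ (2 * s₁)) (h2 : min s₀ (2 * s₁) < u)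
    (hβ1 : ‖α * cexp (-y)‖ ≠ 1) :
    ¬ ∃ᶠ M : ℕ in atTop, ∃ Q : MvPolynomial (Fin 2) ℤ, Q ≠ 0 ∧
      (Q.degreeOf 0 : ℝ) ≤ (M : ℝ) ^ t₀ ∧ (Q.degreeOf 1 : ℝ) ≤ (M : ℝ) ^ t₁ ∧
      (mvPolyHeight Q : ℝ) ≤ Real.exp M ∧
      ∀ k m : ℕ, (k : ℝ) ≤ (M : ℝ) ^ s₀ → (m : ℝ) ≤ (M : ℝ) ^ s₁ →
        ‖aeval ![(m : ℂ) * y, α ^ m] (royD^[k] Q)‖ ≤ Real.exp (-(M : ℝ) ^ u) := by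
  intro hfreq
  have hδ0 : 0 < |‖α * cexp (-y)‖ - 1| := abs_pos.2 (sub_ne_zero.2 hβ1)
  have hcore := prop3_core (y := y) hα hs₀ ht₁ hu h1 h2 (one_pos : (0 : ℝ) < 1)
  have hδev : ∀ᶠ M : ℕ in atTop, 1 ≤ |‖α * cexp (-y)‖ - 1| * (M : ℝ) ^ (1 : ℝ) :=
    tendsto_natCast_atTop_atTop.eventually (eventually_const_le_mul_rpow 1 one_pos hδ0)
  obtain ⟨M, ⟨Q, hQ, hd0, hd1, hH, hsmall⟩, hc, hδM⟩ :=
    (hfreq.and_eventually (hcore.and hδev)).exists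
  exact hc _ hδM (fun j hj _ => abs_norm_sub_one_le_norm_pow_sub_one _ hj) Q hQ hd0 hd1 hH hsmall

/-- **The `∃ᶠ N` mutation of Roy's criterion in rank one HOLDS off the circle** `|αe^{−y}| = 1`
(vacuously: the weakened hypothesis already fails there), for every admissible window.
[cite: Roy2001, Prop. 3] -/
theorem RoyThesisTyped.frequentlyVariantRankOne_of_norm_ne_one (y α : ℂ) (hα : α ≠ 0)
    {s₀ s₁ t₀ t₁ u : ℝ} (hadm : RoyAdmissible s₀ s₁ t₀ t₁ u) (hβ1 : ‖α * cexp (-y)‖ ≠ 1)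
    (hfreq : ∃ᶠ N : ℕ in atTop, ∃ Q : MvPolynomial (Fin 2) ℤ, Q ≠ 0 ∧
      (Q.degreeOf 0 : ℝ) ≤ (N : ℝ) ^ t₀ ∧ (Q.degreeOf 1 : ℝ) ≤ (N : ℝ) ^ t₁ ∧
      (mvPolyHeight Q : ℝ) ≤ Real.exp N ∧
      ∀ k m : ℕ, (k : ℝ) ≤ (N : ℝ) ^ s₀ → (m : ℝ) ≤ (N : ℝ) ^ s₁ →
        ‖aeval ![(m : ℂ) * y, α ^ m] (royD^[k] Q)‖ ≤ Real.exp (-(N : ℝ) ^ u)) :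
    Transcendental ℚ y ∨ Transcendental ℚ α := by
  obtain ⟨hs₀, hs₁, ht₀, ht₁, hu, h1, h2, -⟩ := hadm
  exact absurd hfreq (RoyThesisTyped.not_frequently_conditionB_of_norm_ne_one hα hs₀ ht₁ hu h1
    (lt_of_le_of_lt (min_le_left _ _) (lt_of_le_of_lt (le_max_left _ _) h2)) hβ1)

/-- **On the circle, a finite irrationality measure kills the `∃ᶠ` hypothesis too.** For `α ≠ 0`
with `|αe^{−y}| = 1`, write `αe^{−y} = e^{2πia}`, `a = arg(αe^{−y})/2π`. If `‖ja‖ ≥ c·j^{−μ}` for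
all `j ≥ 1` (finite irrationality measure — for ALGEBRAIC `(y, α)` this is Baker's inhomogeneous
theorem, not in the tree), then the tree's `prop3_core` applies at EVERY large scale (with
`κ = μt₁ + 1`, `δ = 4c·M^{−μt₁}`), so condition (b) fails even for infinitely many `N`.
[cite: Roy2001, Prop. 3 (proof, p. 192)] -/
theorem RoyThesisTyped.not_frequently_conditionB_of_irrationalityMeasure {y α : ℂ} (hα : α ≠ 0)
    {s₀ s₁ t₀ t₁ u : ℝ} (hs₀ : 0 < s₀) (ht₁ : 0 < t₁) (hu : 0 < u)
    (h1 : max 1 (max t₀ (2 * t₁)) < min s₀ (2 * s₁)) (h2 : min s₀ (2 * s₁) < u)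
    (hβ1 : ‖α * cexp (-y)‖ = 1) {c μ : ℝ} (hc : 0 < c) (hμ : 0 ≤ μ)
    (hsep : ∀ j : ℕ, 1 ≤ j →
      c * (j : ℝ) ^ (-μ) ≤ |j * (arg (α * cexp (-y)) / (2 * Real.pi)) -
        round (j * (arg (α * cexp (-y)) / (2 * Real.pi)))|) :
    ¬ ∃ᶠ M : ℕ in atTop, ∃ Q : MvPolynomial (Fin 2) ℤ, Q ≠ 0 ∧
      (Q.degreeOf 0 : ℝ) ≤ (M : ℝ) ^ t₀ ∧ (Q.degreeOf 1 : ℝ) ≤ (M : ℝ) ^ t₁ ∧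
      (mvPolyHeight Q : ℝ) ≤ Real.exp M ∧
      ∀ k m : ℕ, (k : ℝ) ≤ (M : ℝ) ^ s₀ → (m : ℝ) ≤ (M : ℝ) ^ s₁ →
        ‖aeval ![(m : ℂ) * y, α ^ m] (royD^[k] Q)‖ ≤ Real.exp (-(M : ℝ) ^ u) := by
  intro hfreq
  set β : ℂ := α * cexp (-y) with hβ
  set a : ℝ := arg β / (2 * Real.pi) with ha
  have hκ : 0 < μ * t₁ + 1 := by positivity
  have hcore := prop3_core (y := y) hα hs₀ ht₁ hu h1 h2 hκ
  have hM : ∀ᶠ M : ℕ in atTop, 1 ≤ 4 * c * (M : ℝ) ∧ (1 : ℝ) ≤ M := by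
    have H : ∀ᶠ x : ℝ in atTop, 1 ≤ 4 * c * x ∧ 1 ≤ x := by
      filter_upwards [eventually_ge_atTop (max 1 (1 / (4 * c)))] with x hx
      have hx1 : 1 ≤ x := le_trans (le_max_left _ _) hx
      have hx2 : 1 / (4 * c) ≤ x := le_trans (le_max_right _ _) hx
      refine ⟨?_, hx1⟩
      rw [div_le_iff₀ (by positivity)] at hx2
      linarith
    exact tendsto_natCast_atTop_atTop.eventually H
  obtain ⟨M, ⟨Q, hQ, hd0, hd1, hH, hsmall⟩, hc', hM1, hM2⟩ :=
    (hfreq.and_eventually (hcore.and hM)).exists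
  have hM0 : (0 : ℝ) < M := by linarith
  refine hc' (4 * c * (M : ℝ) ^ (-(μ * t₁))) ?_ ?_ Q hQ hd0 hd1 hH hsmall
  · -- `δ M^κ = 4c M ≥ 1`
    have : 4 * c * (M : ℝ) ^ (-(μ * t₁)) * (M : ℝ) ^ (μ * t₁ + 1) = 4 * c * M := by
      rw [mul_assoc, ← Real.rpow_add hM0]
      ring_nf
      rw [Real.rpow_one]
    rw [this]; exact hM1
  · intro j hj1 hjT
    -- `|β^j - 1| ≥ 4 ‖j a‖ ≥ 4 c j^{-μ} ≥ 4 c M^{-μ t₁}`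
    have hj0 : (0 : ℝ) < j := by exact_mod_cast hj1
    have hlow := hsep j hj1
    have h4 := four_mul_abs_sub_round_le ((j : ℝ) * a)
    rw [← pow_eq_exp_of_norm_eq_one hβ1 j] at h4
    have hjμ : (M : ℝ) ^ (-(μ * t₁)) ≤ (j : ℝ) ^ (-μ) := by
      -- j ≤ M^{t₁} ⇒ j^{μ} ≤ M^{μ t₁} ⇒ M^{-μ t₁} ≤ j^{-μ}
      have hjt : (j : ℝ) ^ μ ≤ ((M : ℝ) ^ t₁) ^ μ := Real.rpow_le_rpow hj0.le hjT hμ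
      rw [← Real.rpow_mul hM0.le] at hjt
      rw [Real.rpow_neg hM0.le, Real.rpow_neg hj0.le, mul_comm μ t₁]
      exact inv_anti₀ (Real.rpow_pos_of_pos hj0 μ) hjt
    calc 4 * c * (M : ℝ) ^ (-(μ * t₁)) ≤ 4 * c * (j : ℝ) ^ (-μ) := by gcongr
      _ = 4 * (c * (j : ℝ) ^ (-μ)) := by ring
      _ ≤ 4 * |(j : ℝ) * a - round ((j : ℝ) * a)| := by gcongr
      _ ≤ ‖β ^ j - 1‖ := h4

/-- **The `∃ᶠ N` mutation of Roy's criterion in rank one is TRUE MODULO BAKER.** Hypothesis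
(inline): for algebraic `y ≠ 0`, `α ≠ 0` with `|αe^{−y}| = 1` and `αe^{−y}` not a root of unity,
`a = arg(αe^{−y})/2π` has a finite irrationality measure (a consequence of Baker's lower bound for
`β₀ + β₁ log α₁ + β₂ log α₂` with algebraic `β₀ = −jy`; not in the tree). Conclusion: if the
small-value polynomials exist for infinitely many `N` at `(y, α)` with `y, α ≠ 0` in an admissible
window, then `y` or `α` is transcendental. Off the circle unconditional; on the circle the torsion
case is excluded by Hermite–Lindemann (tree theorem `transcendental_exp_holds`).
[cite: BakerTNT1975, Ch. 3 Thm 3.1] [cite: Roy2001, Prop. 3] -/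
theorem RoyThesisTyped.frequentlyVariantRankOne_of_baker
    (hB : ∀ (y α : ℂ), IsAlgebraic ℚ y → IsAlgebraic ℚ α → y ≠ 0 → α ≠ 0 →
      ‖α * cexp (-y)‖ = 1 → (∀ d : ℕ, 1 ≤ d → (α * cexp (-y)) ^ d ≠ 1) →
      ∃ c μ : ℝ, 0 < c ∧ 0 ≤ μ ∧ ∀ j : ℕ, 1 ≤ j →
        c * (j : ℝ) ^ (-μ) ≤ |j * (arg (α * cexp (-y)) / (2 * Real.pi)) -
          round (j * (arg (α * cexp (-y)) / (2 * Real.pi)))|)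
    (y α : ℂ) (hy : y ≠ 0) (hα : α ≠ 0) {s₀ s₁ t₀ t₁ u : ℝ} (hadm : RoyAdmissible s₀ s₁ t₀ t₁ u)
    (hfreq : ∃ᶠ N : ℕ in atTop, ∃ Q : MvPolynomial (Fin 2) ℤ, Q ≠ 0 ∧
      (Q.degreeOf 0 : ℝ) ≤ (N : ℝ) ^ t₀ ∧ (Q.degreeOf 1 : ℝ) ≤ (N : ℝ) ^ t₁ ∧
      (mvPolyHeight Q : ℝ) ≤ Real.exp N ∧
      ∀ k m : ℕ, (k : ℝ) ≤ (N : ℝ) ^ s₀ → (m : ℝ) ≤ (N : ℝ) ^ s₁ →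
        ‖aeval ![(m : ℂ) * y, α ^ m] (royD^[k] Q)‖ ≤ Real.exp (-(N : ℝ) ^ u)) :
    Transcendental ℚ y ∨ Transcendental ℚ α := by
  by_contra hcon
  rw [not_or] at hcon
  have hya : IsAlgebraic ℚ y := not_not.mp hcon.1
  have hαa : IsAlgebraic ℚ α := not_not.mp hcon.2
  obtain ⟨hs₀, hs₁, ht₀, ht₁, hu, h1, h2, -⟩ := hadm
  have h2' : min s₀ (2 * s₁) < u :=
    lt_of_le_of_lt (min_le_left _ _) (lt_of_le_of_lt (le_max_left _ _) h2)
  rcases eq_or_ne ‖α * cexp (-y)‖ 1 with hβ1 | hβ1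
  · have hrou : ∀ d : ℕ, 1 ≤ d → (α * cexp (-y)) ^ d ≠ 1 := by
      intro d hd h
      obtain ⟨d', hd1', hd'⟩ := (royCondA_iff y α).2 ⟨d, hd, h⟩
      have hd0 : ((d' : ℂ) * y) ≠ 0 := mul_ne_zero (by exact_mod_cast (show d' ≠ 0 by omega)) hy
      exact transcendental_exp_holds ((isAlgebraic_nat d').mul hya) hd0 (hd' ▸ hαa.pow d')
    obtain ⟨c, μ, hc, hμ, hsep⟩ := hB y α hya hαa hy hα hβ1 hrou
    exact RoyThesisTyped.not_frequently_conditionB_of_irrationalityMeasure hα hs₀ ht₁ hu h1 h2' hβ1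
      hc hμ hsep hfreq
  · exact RoyThesisTyped.not_frequently_conditionB_of_norm_ne_one hα hs₀ ht₁ hu h1 h2' hβ1 hfreq

end Summit.Schanuel.Schanuel.Theorems

end
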